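import Summits.ABC.IUTFork.DAGL2s
import Summits.ABC.IUTFork.DAGL4r
import Summits.ABC.IUTFork.DAGRd
import Summits.ABC.IUTFork.DAGXj

/-!
# Kernel DAG index — witness UPGRADE part q (GENERATED by abc-iut-c312-2 gen 6 `work/gen_index.py upgrade` @2026-08-26T21:48Z from HOME/plan/DAG.tsv
(regenerated 2026-08-26T21:23:58Z); spec v1.3 §2(c) "`_holds` iff the DAG row is discharged", §5 "re-file when nodes change status")

THIS FILE PROVES NOTHING NEW AND ASSERTS NOTHING. For 4 nodes ALREADY INDEXED with a partial witness `N_<id>_part` (their DAG row was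
`landed(p…)` when indexed) whose row is NOW `discharged(p…)`, it adds the discharge witness `N_<id>_holds : N_<id> := N_<id>_part` BY NAME —
the node statement `N_<id>` is untouched (append-only across files: nothing landed is redefined). Nothing here says abc is proved or refuted
or takes a side on [IUTchIII] Cor 3.12. typed ≠ discharged; indexed ≠ endorsed.
-/

namespace Summit.ABC.IUTFork.DAG

/-- [node EtTh:Prop3.4(ii) · L2/D1 · DAG status discharged(p464625)] discharge witness of `N_EtTh_Prop3_4_ii'` (indexed in `DAGRd` with `_part` while the row was landed; now discharged, p464625): BY NAME; proves nothing new. -/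
theorem N_EtTh_Prop3_4_ii'_holds : N_EtTh_Prop3_4_ii' := N_EtTh_Prop3_4_ii'_part

/-- [node EtTh:Cor3.8(ii) · L2/D1 · DAG status discharged(p437110)] discharge witness of `N_EtTh_Cor3_8_ii` (indexed in `DAGL2s` with `_part` while the row was landed; now discharged, p437110): BY NAME; proves nothing new. -/
theorem N_EtTh_Cor3_8_ii_holds : N_EtTh_Cor3_8_ii := N_EtTh_Cor3_8_ii_part

/-- [node EtTh:Cor3.8(ii) · L2/D1 · DAG status discharged(p437110)] discharge witness of `N_EtTh_Cor3_8_ii'` (indexed in `DAGXj` with `_part` while the row was landed; now discharged, p437110): BY NAME; proves nothing new. -/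
theorem N_EtTh_Cor3_8_ii'_holds : N_EtTh_Cor3_8_ii' := N_EtTh_Cor3_8_ii'_part

/-- [node AbsTopIII:Cor3.6(v) · L4/D1 · DAG status discharged(p468731)] discharge witness of `N_AbsTopIII_Cor3_6_v` (indexed in `DAGL4r` with `_part` while the row was landed; now discharged, p468731): BY NAME; proves nothing new. -/
theorem N_AbsTopIII_Cor3_6_v_holds : N_AbsTopIII_Cor3_6_v := N_AbsTopIII_Cor3_6_v_part

end Summit.ABC.IUTFork.DAG
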